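import Mathlib.Analysis.Matrix.Order
import Mathlib.NumberTheory.SumFourSquares
import Mathlib.Data.Nat.Size
import HarnessLib

/-!
# Exact Gram certificates `σ² Q = RᵀR` of polynomial bit size for integer matrices with a positive-definiteness margin

Topic `LinearAlgebra/Matrix`. Everything here is PROVED. The main result,
`exists_gram_cert_of_margin`, is the exact-arithmetic fact behind polynomial-size certificates of
positive semidefiniteness as they are used by coNP verifiers (it serves the integer far-ness
certificate `FarCert` of `Algebra/EuclideanLattices/GapCVPCoNPWitness.lean`, Aharonov–Regev 2005,
Thm. 1.1, whose acceptance test (c) is the identity `σ² Q = RᵀR`):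

* `exists_gram_cert_of_margin` — a symmetric integer `n × n` matrix `Q` with
  `uᵀ Q u ≥ 2^{-K} ‖u‖²` for all real `u` and `|Q i k| ≤ 2^S` admits an integer matrix `R` with
  `m ≤ 5(n+1)²` rows and `σ = 2^{O(n+K+S)} ≥ 1` with `σ² Q = RᵀR`, all entries of bit size
  `≤ 9(n + K + S) + 20`.

Construction (folklore; a rounding substitute for the polynomiality of exact Gaussian elimination,
Schrijver 1986, Thm. 3.3, which would give the margin-free statement for all PSD matrices):
1. `Q − 2^{-K-1} I` is positive semidefinite, hence a real Gram matrix `GᵀG` (spectral theorem; in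
   Mathlib through the `C⋆`-algebra order on matrices, `CStarAlgebra.nonneg_iff_eq_star_mul_self`
   with `open scoped MatrixOrder`), and `|G k a|² ≤ Q a a ≤ 2^S`;
2. round `2^T G` (`T = K + S + 2n + 3`) to an integer matrix `H` (`exists_rounded_factor`): the
   perturbation of the Gram entries is `≤ n(2·2^S + 2^{-T-1})2^{-T-1}` (`abs_sum_mul_sub_mul_le`),
   at most `2^{-K-2}/n` summed over a row (`rounding_budget`), so the integer remainder
   `F = 2^{K+1+2T} Q − 2^{K+1} HᵀH = 2^{K+1+2T}(2^{-K-1} I + Δ)` is DIAGONALLY DOMINANT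
   (`diag_sub_sum_abs_nonneg`, `ddSlack_nonneg_of_real`);
3. twice a symmetric integer matrix is the explicit combination
   `2F = ∑_{i≠j} |F i j| (eᵢ + sgn(F i j) eⱼ)(eᵢ + sgn(F i j) eⱼ)ᵀ + ∑ᵢ 2 rᵢ eᵢ eᵢᵀ` with the slacks
   `rᵢ = F i i − ∑_{j≠i} |F i j|` (`sum_ddCoeff_mul_ddVec_add`), nonnegative here; writing each
   coefficient `2σ₀|F i j|`, `4σ₀ rᵢ` as four squares (Lagrange, `Nat.sum_four_squares`) turns
   `(2σ₀)² Q = (2^{K+2+T} H)ᵀ(2^{K+2+T} H) + 2σ₀ · 2F` into a single Gram identity `RᵀR`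
   (`certMatrix_gram`), `σ₀ = 2^{K+1+2T}`;
4. sizes: every entry is at most `2^{9(n+K+S)+19}`.

## References

* A. Schrijver, *Theory of Linear and Integer Programming*, Wiley 1986, §3.3 (Thm. 3.3: the
  polynomiality of Gaussian elimination) — background for the margin-free statement, not used.
* D. Aharonov, O. Regev, *Lattice problems in NP ∩ coNP*, J. ACM 52 (2005), §6 (the verifier's
  eigenvalue test, here certified exactly).
-/

noncomputable section

open Matrix Finset
open scoped MatrixOrder ComplexOrder

namespace Literature.LinearAlgebra.Matrix

variable {n : ℕ}

/-! ### The diagonal-dominance decomposition of twice a symmetric integer matrix -/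

/-- Off-diagonal coefficients `c i j = |F i j|` (`0` on the diagonal). [folklore] -/
def ddCoeff (F : Matrix (Fin n) (Fin n) ℤ) (i j : Fin n) : ℤ := if i = j then 0 else |F i j|

/-- The diagonal-dominance slack `r a = F a a − ∑_{b ≠ a} |F a b|`. [folklore] -/
def ddSlack (F : Matrix (Fin n) (Fin n) ℤ) (a : Fin n) : ℤ := F a a - ∑ b, ddCoeff F a b

/-- The Kronecker vector `e i`. [folklore] -/
def kron (i a : Fin n) : ℤ := if a = i then 1 else 0

/-- The vectors `v i j = e i + sign(F i j) e j` of the decomposition. [folklore] -/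
def ddVec (F : Matrix (Fin n) (Fin n) ℤ) (i j : Fin n) (a : Fin n) : ℤ := kron i a + Int.sign (F i j) * kron j a

omit n in
/-- `∑ᵢ [a = i][c = i] X i = [a = c] X a`. [folklore] -/
theorem sum_kron_mul_kron {n : ℕ} (X : Fin n → ℤ) (a c : Fin n) :
    ∑ i, kron i a * kron i c * X i = if a = c then X a else 0 := by
  unfold kron
  rw [Finset.sum_eq_single a]
  · by_cases h : a = c
    · subst h; simp
    · simp [h, Ne.symm h]
  · intro i _ hi
    simp [Ne.symm hi]
  · simp

/-- `∑ᵢ ∑ⱼ [a = i][c = j] Y i j = Y a c`. [folklore] -/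
theorem sum_sum_kron_mul_kron (Y : Fin n → Fin n → ℤ) (a c : Fin n) :
    ∑ i, ∑ j, kron i a * kron j c * Y i j = Y a c := by
  unfold kron
  rw [Finset.sum_eq_single a]
  · rw [Finset.sum_eq_single c]
    · simp
    · intro j _ hj; simp [Ne.symm hj]
    · simp
  · intro i _ hi; simp [Ne.symm hi]
  · simp

/-- `|x| · sign x · y`-type simplification: `c i j · sign (F i j) = [i ≠ j] F i j`. [folklore] -/
theorem ddCoeff_mul_sign (F : Matrix (Fin n) (Fin n) ℤ) (i j : Fin n) :
    ddCoeff F i j * Int.sign (F i j) = if i = j then 0 else F i j := by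
  unfold ddCoeff
  split_ifs
  · simp
  · rw [Int.abs_eq_natAbs, mul_comm, Int.sign_mul_natAbs]

/-- `c i j · sign² = c i j`. [folklore] -/
theorem ddCoeff_mul_sign_sq (F : Matrix (Fin n) (Fin n) ℤ) (i j : Fin n) :
    ddCoeff F i j * (Int.sign (F i j) * Int.sign (F i j)) = ddCoeff F i j := by
  unfold ddCoeff
  split_ifs
  · simp
  · rcases eq_or_ne (F i j) 0 with h | h
    · simp [h]
    · rcases lt_or_gt_of_ne h with hlt | hgt
      · simp [Int.sign_eq_neg_one_of_neg hlt]
      · simp [Int.sign_eq_one_of_pos hgt]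

/-- Symmetry of the coefficients for symmetric `F`. [folklore] -/
theorem ddCoeff_comm {F : Matrix (Fin n) (Fin n) ℤ} (hF : Fᵀ = F) (i j : Fin n) : ddCoeff F i j = ddCoeff F j i := by
  unfold ddCoeff
  have h : F j i = F i j := by
    have := congrFun (congrFun hF i) j; rwa [transpose_apply] at this
  by_cases hij : i = j
  · subst hij; simp
  · simp [hij, Ne.symm hij, h]

/-- **The decomposition identity**: for symmetric `F`,
`∑_{i,j} c_{ij} v_{ij}(a) v_{ij}(c) + ∑ᵢ 2 rᵢ [a = i][c = i] = 2 F a c` — twice a symmetric integer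
matrix is an explicit nonnegative-looking combination of rank-one forms `v vᵀ` (`v = eᵢ ± eⱼ`, `eᵢ`)
with coefficients `|F i j|` and the slacks `rᵢ` (nonnegative exactly when `F` is diagonally
dominant). [folklore] -/
theorem sum_ddCoeff_mul_ddVec_add (F : Matrix (Fin n) (Fin n) ℤ) (hF : Fᵀ = F) (a c : Fin n) :
    (∑ p : Fin n × Fin n, ddCoeff F p.1 p.2 * ddVec F p.1 p.2 a * ddVec F p.1 p.2 c) +
      ∑ i, 2 * ddSlack F i * kron i a * kron i c = 2 * F a c := by
  -- expand `v v` into four terms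
  have hexp : ∀ i j, ddCoeff F i j * ddVec F i j a * ddVec F i j c =
      kron i a * kron i c * ddCoeff F i j + kron i a * kron j c * (ddCoeff F i j * Int.sign (F i j)) +
        kron j a * kron i c * (ddCoeff F i j * Int.sign (F i j)) +
        kron j a * kron j c * (ddCoeff F i j * (Int.sign (F i j) * Int.sign (F i j))) := by
    intro i j; unfold ddVec; ring
  simp_rw [Fintype.sum_prod_type, hexp, ddCoeff_mul_sign, ddCoeff_mul_sign_sq, Finset.sum_add_distrib]
  -- T1 = [a=c] Σ_j c a j
  have hT1 : ∑ i, ∑ j, kron i a * kron i c * ddCoeff F i j = if a = c then ∑ j, ddCoeff F a j else 0 := by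
    simp_rw [← Finset.mul_sum]
    exact sum_kron_mul_kron (fun i => ∑ j, ddCoeff F i j) a c
  -- T2 = [a ≠ c] F a c
  have hT2 : ∑ i, ∑ j, kron i a * kron j c * (if i = j then 0 else F i j) = if a = c then 0 else F a c :=
    sum_sum_kron_mul_kron (fun i j => if i = j then 0 else F i j) a c
  -- T3 = [c ≠ a] F c a
  have hT3 : ∑ i, ∑ j, kron j a * kron i c * (if i = j then 0 else F i j) = if c = a then 0 else F c a := by
    rw [Finset.sum_comm]
    have := sum_sum_kron_mul_kron (fun j i => if i = j then 0 else F i j) a c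
    simpa [mul_comm] using this
  -- T4 = [a=c] Σ_i c i a
  have hT4 : ∑ i, ∑ j, kron j a * kron j c * ddCoeff F i j = if a = c then ∑ i, ddCoeff F i a else 0 := by
    rw [Finset.sum_comm]
    simp_rw [← Finset.mul_sum]
    exact sum_kron_mul_kron (fun j => ∑ i, ddCoeff F i j) a c
  -- slack term
  have hT5 : ∑ i, 2 * ddSlack F i * kron i a * kron i c = if a = c then 2 * ddSlack F a else 0 := by
    have := sum_kron_mul_kron (fun i => 2 * ddSlack F i) a c
    simpa [mul_comm, mul_assoc, mul_left_comm] using this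
  rw [hT1, hT2, hT3, hT4, hT5]
  by_cases hac : a = c
  · subst hac
    simp only [if_true]
    have hsym : ∑ i, ddCoeff F i a = ∑ j, ddCoeff F a j := Finset.sum_congr rfl fun i _ => ddCoeff_comm hF i a
    rw [hsym, ddSlack]
    ring
  · have hca : ¬ c = a := fun h => hac h.symm
    have hs : F c a = F a c := by
      have := congrFun (congrFun hF a) c; rwa [transpose_apply] at this
    simp only [hac, hca, if_false, hs]
    ring

/-! ### Gram matrices of row families -/

/-- `(RᵀR) a c = ∑_r R r a · R r c`. [folklore] -/
theorem transpose_mul_self_apply {m : Type*} [Fintype m] (R : Matrix m (Fin n) ℤ) (a c : Fin n) :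
    (Rᵀ * R) a c = ∑ r, R r a * R r c := by
  simp [Matrix.mul_apply]

/-- Reindexing the rows does not change `RᵀR`. [folklore] -/
theorem transpose_mul_self_reindex {m m' : Type*} [Fintype m] [Fintype m'] (e : m ≃ m') (R : Matrix m (Fin n) ℤ) :
    (Matrix.of fun (r : m') (a : Fin n) => R (e.symm r) a)ᵀ * (Matrix.of fun (r : m') (a : Fin n) => R (e.symm r) a) = Rᵀ * R := by
  ext a c
  rw [transpose_mul_self_apply, transpose_mul_self_apply]
  simp only [Matrix.of_apply]
  exact e.symm.sum_comp (fun r => R r a * R r c)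

/-! ### Four squares -/

/-- Lagrange: every natural number is `∑_{l<4} x_l²`. [folklore] -/
theorem exists_sum_fin_four_sq (c : ℕ) : ∃ x : Fin 4 → ℤ, ∑ l, x l * x l = c := by
  obtain ⟨a, b, d, e, h⟩ := Nat.sum_four_squares c
  refine ⟨![a, b, d, e], ?_⟩
  simp [Fin.sum_univ_four]
  exact_mod_cast (by simpa [sq] using h)


/-! ### Analysis: a rounded real Gram factor leaves a diagonally dominant remainder -/

/-- Perturbation of Gram entries: `|∑ₖ (G_{ka}G_{kb} − G'_{ka}G'_{kb})| ≤ n (2B + η) η` when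
`|G| ≤ B` and `|G − G'| ≤ η` entrywise. [folklore] -/
theorem abs_sum_mul_sub_mul_le {G G' : Matrix (Fin n) (Fin n) ℝ} {B η : ℝ} (hη : 0 ≤ η)
    (hG : ∀ k a, |G k a| ≤ B) (hd : ∀ k a, |G k a - G' k a| ≤ η) (a b : Fin n) :
    |∑ k, (G k a * G k b - G' k a * G' k b)| ≤ n * ((2 * B + η) * η) := by
  have hB : 0 ≤ B := (abs_nonneg _).trans (hG a a)
  calc |∑ k, (G k a * G k b - G' k a * G' k b)| ≤ ∑ k, |G k a * G k b - G' k a * G' k b| := Finset.abs_sum_le_sum_abs _ _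
    _ ≤ ∑ _k : Fin n, (2 * B + η) * η := Finset.sum_le_sum fun k _ => by
        have e : G k a * G k b - G' k a * G' k b = (G k a - G' k a) * G k b + G' k a * (G k b - G' k b) := by ring
        rw [e]
        have hG' : |G' k a| ≤ B + η := by
          have h1 := abs_sub_abs_le_abs_sub (G' k a) (G k a)
          rw [abs_sub_comm] at h1
          linarith [hG k a, hd k a]
        calc |(G k a - G' k a) * G k b + G' k a * (G k b - G' k b)|
            ≤ |(G k a - G' k a) * G k b| + |G' k a * (G k b - G' k b)| := abs_add_le _ _
          _ = |G k a - G' k a| * |G k b| + |G' k a| * |G k b - G' k b| := by rw [abs_mul, abs_mul]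
          _ ≤ η * B + (B + η) * η := add_le_add (mul_le_mul (hd k a) (hG k b) (abs_nonneg _) hη)
              (mul_le_mul hG' (hd k b) (abs_nonneg _) (by linarith))
          _ = (2 * B + η) * η := by ring
    _ = n * ((2 * B + η) * η) := by simp

/-- Diagonal dominance of `E = (μ/2) I + Δ` when `∑_b |Δ_{ab}| ≤ μ/2`. [folklore] -/
theorem diag_sub_sum_abs_nonneg {μ : ℝ} {E Δ : Fin n → Fin n → ℝ} (a : Fin n)
    (hE : ∀ b, E a b = (if a = b then μ / 2 else 0) + Δ a b) (hΔ : ∑ b, |Δ a b| ≤ μ / 2) :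
    0 ≤ E a a - ∑ b, (if a = b then 0 else |E a b|) := by
  have h1 : ∑ b, (if a = b then 0 else |E a b|) = ∑ b, (if a = b then 0 else |Δ a b|) :=
    Finset.sum_congr rfl fun b _ => by
      by_cases h : a = b
      · simp [h]
      · simp [h, hE b]
  have h2 : ∑ b, (if a = b then 0 else |Δ a b|) + |Δ a a| = ∑ b, |Δ a b| := by
    have h3 : |Δ a a| = ∑ b, (if a = b then |Δ a b| else 0) := by rw [Finset.sum_ite_eq]; simp
    rw [h3, ← Finset.sum_add_distrib]
    exact Finset.sum_congr rfl fun b _ => by split_ifs <;> simp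
  have h4 : E a a = μ / 2 + Δ a a := by rw [hE a]; simp
  rw [h1, h4]
  have h5 : -|Δ a a| ≤ Δ a a := neg_abs_le _
  linarith

/-- The slack of an integer matrix is nonnegative if it is a positive multiple of a diagonally
dominant real matrix. [folklore] -/
theorem ddSlack_nonneg_of_real {F : Matrix (Fin n) (Fin n) ℤ} {σ : ℝ} (hσ : 0 < σ) {E : Fin n → Fin n → ℝ}
    (a : Fin n) (hF : ∀ b, ((F a b : ℤ) : ℝ) = σ * E a b) (hE : 0 ≤ E a a - ∑ b, (if a = b then 0 else |E a b|)) :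
    0 ≤ ddSlack F a := by
  have h1 : ∀ b, ((ddCoeff F a b : ℤ) : ℝ) = σ * (if a = b then 0 else |E a b|) := by
    intro b
    unfold ddCoeff
    split_ifs
    · simp
    · rw [Int.cast_abs, hF b, abs_mul, abs_of_pos hσ]
  have h : (0 : ℝ) ≤ ((ddSlack F a : ℤ) : ℝ) := by
    unfold ddSlack
    push_cast
    simp_rw [h1, ← Finset.mul_sum, hF a, ← mul_sub]
    exact mul_nonneg hσ.le hE
  exact_mod_cast h

/-- The numerical budget of the rounding: with `D = 2^{K+S+2n+3}`,
`n · n (2·2^S + 1/(2D)) / (2D) ≤ (1/2^K)/2`. [folklore] -/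
theorem rounding_budget (n K S : ℕ) :
    (n : ℝ) * (n * ((2 * 2 ^ S + 1 / (2 * (2 : ℝ) ^ (K + S + 2 * n + 3))) * (1 / (2 * (2 : ℝ) ^ (K + S + 2 * n + 3))))) ≤
      1 / 2 ^ K / 2 := by
  set D : ℝ := (2 : ℝ) ^ (K + S + 2 * n + 3) with hD
  have hD0 : 0 < D := by positivity
  have hD1 : 1 ≤ D := one_le_pow₀ (by norm_num)
  -- `2·2^S + 1/(2D) ≤ 2^(S+2)`
  have h1 : 2 * (2 : ℝ) ^ S + 1 / (2 * D) ≤ (2 : ℝ) ^ (S + 2) := by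
    have h2 : 1 / (2 * D) ≤ 1 := by rw [div_le_one (by positivity)]; linarith
    have h3 : (1 : ℝ) ≤ 2 ^ S := one_le_pow₀ (by norm_num)
    rw [pow_add]; nlinarith
  -- `n² ≤ 2^(2n)`
  have h4 : (n : ℝ) * n ≤ (2 : ℝ) ^ (2 * n) := by
    have h5 : n * n ≤ 2 ^ (2 * n) := by
      calc n * n ≤ 2 ^ n * 2 ^ n := Nat.mul_le_mul Nat.lt_two_pow_self.le Nat.lt_two_pow_self.le
        _ = 2 ^ (2 * n) := by rw [← pow_add]; ring_nf
    exact_mod_cast h5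
  have hn0 : (0 : ℝ) ≤ n := Nat.cast_nonneg _
  -- main estimate
  have h6 : (n : ℝ) * (n * ((2 * 2 ^ S + 1 / (2 * D)) * (1 / (2 * D)))) ≤ (2 : ℝ) ^ (2 * n) * ((2 : ℝ) ^ (S + 2) * (1 / (2 * D))) := by
    have h7 : (2 * 2 ^ S + 1 / (2 * D)) * (1 / (2 * D)) ≤ (2 : ℝ) ^ (S + 2) * (1 / (2 * D)) :=
      mul_le_mul_of_nonneg_right h1 (by positivity)
    calc (n : ℝ) * (n * ((2 * 2 ^ S + 1 / (2 * D)) * (1 / (2 * D))))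
        = (n * n) * ((2 * 2 ^ S + 1 / (2 * D)) * (1 / (2 * D))) := by ring
      _ ≤ (2 : ℝ) ^ (2 * n) * ((2 : ℝ) ^ (S + 2) * (1 / (2 * D))) :=
          mul_le_mul h4 h7 (by positivity) (by positivity)
  refine h6.trans ?_
  have e : (2 : ℝ) ^ (K + S + 2 * n + 3) = 2 ^ K * 2 ^ S * 2 ^ (2 * n) * 2 ^ 3 := by
    rw [pow_add, pow_add, pow_add]
  have e2 : (2 : ℝ) ^ (2 * n) * ((2 : ℝ) ^ (S + 2) * (1 / (2 * D))) = 1 / 2 ^ K / 4 := by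
    rw [hD, e, pow_add]
    field_simp
    ring
  rw [e2]
  have : (0 : ℝ) < 1 / 2 ^ K := by positivity
  linarith

/-- **The rounded factor.** For a symmetric integer matrix `Q` with `uᵀQu ≥ 2^{-K}‖u‖²` and entries
`≤ 2^S`: round `2^T G`, `G` a real Gram factor of `Q − 2^{-K-1} I` (`T = K + S + 2n + 3`), to an
integer matrix `H`; then `|H| ≤ 2^{T+S} + 1` and `F = 2^{K+1+2T} Q − 2^{K+1} HᵀH` is diagonally
dominant (all slacks `≥ 0`). [folklore] -/
theorem exists_rounded_factor (n K S : ℕ) (Q : Matrix (Fin n) (Fin n) ℤ) (hQ : Qᵀ = Q)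
    (hmargin : ∀ u : Fin n → ℝ, u ⬝ᵥ u ≤ 2 ^ K * (u ⬝ᵥ (Q.map (Int.cast : ℤ → ℝ) *ᵥ u)))
    (hS : ∀ i k, (Q i k).natAbs ≤ 2 ^ S) :
    ∃ H : Matrix (Fin n) (Fin n) ℤ, (∀ k a, (H k a).natAbs ≤ 2 ^ (K + S + 2 * n + 3) * 2 ^ S + 1) ∧
      ∀ a, 0 ≤ ddSlack (((2 : ℤ) ^ (K + 1 + 2 * (K + S + 2 * n + 3))) • Q - ((2 : ℤ) ^ (K + 1)) • (Hᵀ * H)) a := by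
  set T : ℕ := K + S + 2 * n + 3 with hT
  set μ : ℝ := 1 / 2 ^ K with hμ
  have hμ0 : 0 < μ := by positivity
  set Qr : Matrix (Fin n) (Fin n) ℝ := Q.map (Int.cast : ℤ → ℝ) with hQr
  set Q' : Matrix (Fin n) (Fin n) ℝ := Qr - (μ / 2) • (1 : Matrix (Fin n) (Fin n) ℝ) with hQ'
  -- `Q'` is positive semidefinite, hence a Gram matrix
  have hQ't : Q'ᵀ = Q' := by
    rw [hQ', transpose_sub, transpose_smul, transpose_one, hQr, ← transpose_map, hQ]
  have hquad : ∀ x : Fin n → ℝ, 0 ≤ x ⬝ᵥ (Q' *ᵥ x) := by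
    intro x
    have h1 := hmargin x
    have hx0 : 0 ≤ x ⬝ᵥ x := Finset.sum_nonneg fun i _ => mul_self_nonneg _
    have h2 : x ⬝ᵥ (Q' *ᵥ x) = x ⬝ᵥ (Qr *ᵥ x) - μ / 2 * (x ⬝ᵥ x) := by
      rw [hQ', sub_mulVec, dotProduct_sub, smul_mulVec, one_mulVec, dotProduct_smul, smul_eq_mul]
    rw [h2]
    have h3 : μ * (x ⬝ᵥ x) ≤ x ⬝ᵥ (Qr *ᵥ x) := by
      rw [hμ, one_div, inv_mul_le_iff₀ (by positivity)]; exact h1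
    nlinarith
  have hpsd : Q'.PosSemidef := by
    refine PosSemidef.of_dotProduct_mulVec_nonneg ?_ (fun x => by simpa using hquad x)
    rw [IsHermitian, conjTranspose_eq_transpose_of_trivial]; exact hQ't
  obtain ⟨G, hG⟩ : ∃ G : Matrix (Fin n) (Fin n) ℝ, Q' = Gᵀ * G := by
    obtain ⟨B, hB⟩ := CStarAlgebra.nonneg_iff_eq_star_mul_self.mp hpsd.nonneg
    exact ⟨B, by rw [hB, star_eq_conjTranspose, conjTranspose_eq_transpose_of_trivial]⟩
  -- entries of `G` are at most `2^S`
  have hQd : ∀ a b, (Q a b : ℝ) = (∑ k, G k a * G k b) + (if a = b then μ / 2 else 0) := by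
    intro a b
    have e := congrFun (congrFun hG a) b
    simp only [hQ', hQr, Matrix.sub_apply, Matrix.smul_apply, Matrix.map_apply, Matrix.mul_apply, Matrix.transpose_apply,
      Matrix.one_apply, smul_eq_mul, mul_ite, mul_one, mul_zero] at e
    linarith
  have hGB : ∀ k a, |G k a| ≤ (2 : ℝ) ^ S := by
    intro k a
    have h1 : G k a * G k a ≤ ∑ x, G x a * G x a :=
      Finset.single_le_sum (f := fun x => G x a * G x a) (fun x _ => mul_self_nonneg _) (Finset.mem_univ k)
    have h2 : ∑ x, G x a * G x a ≤ (2 : ℝ) ^ S := by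
      have h3 := hQd a a
      simp only [if_true] at h3
      have h4 : (Q a a : ℝ) ≤ (2 : ℝ) ^ S := by
        have h5 : |(Q a a : ℝ)| ≤ (2 : ℝ) ^ S := by
          rw [← Int.cast_abs, Int.abs_eq_natAbs]; exact_mod_cast hS a a
        linarith [le_abs_self ((Q a a : ℝ))]
      linarith
    have h1S : (1 : ℝ) ≤ 2 ^ S := one_le_pow₀ (by norm_num)
    refine abs_le_of_sq_le_sq ?_ (by positivity)
    nlinarith
  -- rounding at scale `D = 2^T`
  set D : ℝ := (2 : ℝ) ^ T with hD
  have hD0 : 0 < D := by positivity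
  let H : Matrix (Fin n) (Fin n) ℤ := Matrix.of fun k a => round (D * G k a)
  have hHr : ∀ k a, |D * G k a - (H k a : ℝ)| ≤ 1 / 2 := fun k a => by
    simp only [H, Matrix.of_apply]; exact abs_sub_round _
  refine ⟨H, fun k a => ?_, fun a => ?_⟩
  · -- `|H| ≤ D 2^S + 1`
    have h1 : |(H k a : ℝ)| ≤ D * 2 ^ S + 1 / 2 := by
      have h2 := abs_sub_abs_le_abs_sub (H k a : ℝ) (D * G k a)
      rw [abs_sub_comm] at h2
      have h3 : |D * G k a| ≤ D * 2 ^ S := by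
        rw [abs_mul, abs_of_pos hD0]; exact mul_le_mul_of_nonneg_left (hGB k a) hD0.le
      linarith [hHr k a]
    have h4 : ((H k a).natAbs : ℝ) = |((H k a : ℤ) : ℝ)| := by
      rw [← Int.cast_abs, ← Int.natCast_natAbs, Int.cast_natCast]
    have h5 : ((H k a).natAbs : ℝ) ≤ ((2 ^ T * 2 ^ S + 1 : ℕ) : ℝ) := by
      rw [h4]; push_cast; rw [← hD]; linarith
    exact_mod_cast h5
  · -- diagonal dominance of `F`
    set G' : Matrix (Fin n) (Fin n) ℝ := Matrix.of fun k a => (H k a : ℝ) / D with hG'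
    have hHG' : ∀ k c, (H k c : ℝ) = D * G' k c := fun k c => by
      simp only [hG', Matrix.of_apply]; field_simp
    have hdiff : ∀ k b, |G k b - G' k b| ≤ 1 / (2 * D) := by
      intro k b
      have e : G k b - G' k b = (D * G k b - H k b) / D := by
        simp only [hG', Matrix.of_apply]; field_simp
      rw [e, abs_div, abs_of_pos hD0, div_le_div_iff₀ hD0 (by positivity)]
      have := hHr k b
      nlinarith
    set Δ : Fin n → Fin n → ℝ := fun a b => ∑ k, (G k a * G k b - G' k a * G' k b) with hΔ
    set E : Fin n → Fin n → ℝ := fun a b => (Q a b : ℝ) - ∑ k, G' k a * G' k b with hE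
    have hEΔ : ∀ b, E a b = (if a = b then μ / 2 else 0) + Δ a b := by
      intro b
      simp only [hE, hΔ, Finset.sum_sub_distrib, hQd a b]
      ring
    have hΔsum : ∑ b, |Δ a b| ≤ μ / 2 := by
      have hb : ∀ b, |Δ a b| ≤ n * ((2 * 2 ^ S + 1 / (2 * D)) * (1 / (2 * D))) := fun b =>
        abs_sum_mul_sub_mul_le (by positivity) hGB hdiff a b
      calc ∑ b, |Δ a b| ≤ ∑ _b : Fin n, (n : ℝ) * ((2 * 2 ^ S + 1 / (2 * D)) * (1 / (2 * D))) :=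
            Finset.sum_le_sum fun b _ => hb b
        _ = n * (n * ((2 * 2 ^ S + 1 / (2 * D)) * (1 / (2 * D)))) := by simp
        _ ≤ 1 / 2 ^ K / 2 := by rw [hD, hT]; exact rounding_budget n K S
        _ = μ / 2 := by rw [hμ]
    have hσr : (0 : ℝ) < 2 ^ (K + 1) * D ^ 2 := by positivity
    refine ddSlack_nonneg_of_real hσr a (fun b => ?_) (diag_sub_sum_abs_nonneg a hEΔ hΔsum)
    -- `F a b = 2^{K+1} D² · E a b`
    simp only [Matrix.sub_apply, Matrix.smul_apply, smul_eq_mul, Matrix.mul_apply, Matrix.transpose_apply, hE]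
    push_cast
    simp_rw [hHG']
    have e2 : (2 : ℝ) ^ (K + 1 + 2 * T) = 2 ^ (K + 1) * D ^ 2 := by rw [hD, pow_add, pow_mul']
    rw [e2, Finset.mul_sum, mul_sub, Finset.mul_sum]
    congr 1
    refine Finset.sum_congr rfl fun k _ => ?_
    ring


/-! ### Assembly: the certificate and its size -/

/-- The row type of the certificate: `n` rows for the rounded factor, `4` rows per ordered pair for
the off-diagonal terms, `4` rows per index for the slacks. [folklore] -/
abbrev CertRows (n : ℕ) : Type := Fin n ⊕ ((Fin n × Fin n) × Fin 4) ⊕ (Fin n × Fin 4)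

/-- The certificate matrix before reindexing its rows by `Fin m`. [folklore] -/
def certMatrix (lam : ℤ) (H F : Matrix (Fin n) (Fin n) ℤ) (x : Fin n × Fin n → Fin 4 → ℤ) (y : Fin n → Fin 4 → ℤ) :
    Matrix (CertRows n) (Fin n) ℤ :=
  Matrix.of fun r a => match r with
    | Sum.inl k => lam * H k a
    | Sum.inr (Sum.inl (p, l)) => x p l * ddVec F p.1 p.2 a
    | Sum.inr (Sum.inr (i, l)) => y i l * kron i a

/-- **The Gram identity of the certificate**: if `∑_l x_{pl}² = 2σ₀ c_p`, `∑_l y_{il}² = 4σ₀ rᵢ`,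
`F = σ₀ Q − ν HᵀH` is symmetric and `λ² = 4σ₀ν`, then `RᵀR = (2σ₀)² Q`. [folklore] -/
theorem certMatrix_gram {lam σ₀ ν : ℤ} {Q H F : Matrix (Fin n) (Fin n) ℤ} {x : Fin n × Fin n → Fin 4 → ℤ}
    {y : Fin n → Fin 4 → ℤ} (hF : F = σ₀ • Q - ν • (Hᵀ * H)) (hFt : Fᵀ = F) (hlam : lam * lam = 4 * σ₀ * ν)
    (hx : ∀ p, ∑ l, x p l * x p l = 2 * σ₀ * ddCoeff F p.1 p.2) (hy : ∀ i, ∑ l, y i l * y i l = 4 * σ₀ * ddSlack F i) :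
    (certMatrix lam H F x y)ᵀ * certMatrix lam H F x y = ((2 * σ₀) ^ 2) • Q := by
  ext a c
  rw [transpose_mul_self_apply]
  simp only [certMatrix, Matrix.of_apply, Fintype.sum_sum_type, Fintype.sum_prod_type, Matrix.smul_apply, smul_eq_mul]
  -- the three blocks
  have h1 : ∑ k, lam * H k a * (lam * H k c) = lam * lam * (Hᵀ * H) a c := by
    rw [Matrix.mul_apply, Finset.mul_sum]
    exact Finset.sum_congr rfl fun k _ => by rw [transpose_apply]; ring
  have h2 : ∑ i, ∑ j, ∑ l, x (i, j) l * ddVec F i j a * (x (i, j) l * ddVec F i j c) =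
      2 * σ₀ * ∑ p : Fin n × Fin n, ddCoeff F p.1 p.2 * ddVec F p.1 p.2 a * ddVec F p.1 p.2 c := by
    rw [Fintype.sum_prod_type, Finset.mul_sum]
    refine Finset.sum_congr rfl fun i _ => ?_
    rw [Finset.mul_sum]
    refine Finset.sum_congr rfl fun j _ => ?_
    have e : ∑ l, x (i, j) l * ddVec F i j a * (x (i, j) l * ddVec F i j c) =
        (∑ l, x (i, j) l * x (i, j) l) * (ddVec F i j a * ddVec F i j c) := by
      rw [Finset.sum_mul]; exact Finset.sum_congr rfl fun l _ => by ring
    rw [e, hx (i, j)]; ring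
  have h3 : ∑ i, ∑ l, y i l * kron i a * (y i l * kron i c) = 2 * σ₀ * ∑ i, 2 * ddSlack F i * kron i a * kron i c := by
    rw [Finset.mul_sum]
    refine Finset.sum_congr rfl fun i _ => ?_
    have e : ∑ l, y i l * kron i a * (y i l * kron i c) = (∑ l, y i l * y i l) * (kron i a * kron i c) := by
      rw [Finset.sum_mul]; exact Finset.sum_congr rfl fun l _ => by ring
    rw [e, hy i]; ring
  rw [h1, h2, h3, ← mul_add, sum_ddCoeff_mul_ddVec_add F hFt a c, hlam]
  have hFac : F a c = σ₀ * Q a c - ν * (Hᵀ * H) a c := by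
    rw [hF, Matrix.sub_apply, Matrix.smul_apply, Matrix.smul_apply, smul_eq_mul, smul_eq_mul]
  rw [hFac]
  ring

/-- `|v_{ij}(a)| ≤ 2`. [folklore] -/
theorem natAbs_ddVec_le (F : Matrix (Fin n) (Fin n) ℤ) (i j a : Fin n) : (ddVec F i j a).natAbs ≤ 2 := by
  unfold ddVec kron
  have hs : (Int.sign (F i j)).natAbs ≤ 1 := by
    rcases lt_trichotomy (F i j) 0 with h | h | h
    · simp [Int.sign_eq_neg_one_of_neg h]
    · simp [h]
    · simp [Int.sign_eq_one_of_pos h]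
  refine (Int.natAbs_add_le _ _).trans ?_
  rw [Int.natAbs_mul]
  split_ifs <;> simp <;> omega

/-- `kron ∈ {0, 1}`. [folklore] -/
theorem natAbs_kron_le (i a : Fin n) : (kron i a).natAbs ≤ 1 := by
  unfold kron; split_ifs <;> simp

/-- `0 ≤ c_{ij}` and `|c_{ij}| ≤ |F i j|`. [folklore] -/
theorem ddCoeff_nonneg (F : Matrix (Fin n) (Fin n) ℤ) (i j : Fin n) : 0 ≤ ddCoeff F i j := by
  unfold ddCoeff; split_ifs <;> simp

/-- `|c_{ij}| ≤ |F i j|`. [folklore] -/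
theorem natAbs_ddCoeff_le (F : Matrix (Fin n) (Fin n) ℤ) (i j : Fin n) : (ddCoeff F i j).natAbs ≤ (F i j).natAbs := by
  unfold ddCoeff; split_ifs <;> simp [Int.natAbs_abs]

/-- `0 ≤ rᵢ ≤ F i i` when the slack is nonnegative. [folklore] -/
theorem natAbs_ddSlack_le {F : Matrix (Fin n) (Fin n) ℤ} {i : Fin n} (h : 0 ≤ ddSlack F i) :
    (ddSlack F i).natAbs ≤ (F i i).natAbs := by
  have h1 : ddSlack F i ≤ F i i := by
    unfold ddSlack
    have : 0 ≤ ∑ b, ddCoeff F i b := Finset.sum_nonneg fun b _ => ddCoeff_nonneg F i b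
    linarith
  have h2 : ((ddSlack F i).natAbs : ℤ) ≤ ((F i i).natAbs : ℤ) := by
    rw [Int.natAbs_of_nonneg h, Int.natCast_natAbs]
    exact h1.trans (le_abs_self _)
  exact_mod_cast h2

/-- A square-sum bound: `∑_l x_l² = c ≥ 0` implies `|x_l| ≤ c`. [folklore] -/
theorem natAbs_le_of_sum_sq_eq {x : Fin 4 → ℤ} {c : ℤ} (h : ∑ l, x l * x l = c) (l : Fin 4) : ((x l).natAbs : ℤ) ≤ c := by
  have h1 : x l * x l ≤ c := by
    rw [← h]
    exact Finset.single_le_sum (f := fun l => x l * x l) (fun l _ => mul_self_nonneg _) (Finset.mem_univ l)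
  have h2 : ((x l).natAbs : ℤ) ≤ x l ^ 2 := Int.natAbs_le_self_sq _
  rw [sq] at h2
  exact h2.trans h1

/-- Entries of `HᵀH`. [folklore] -/
theorem natAbs_transpose_mul_self_le {H : Matrix (Fin n) (Fin n) ℤ} {M : ℕ} (hH : ∀ k a, (H k a).natAbs ≤ M) (a b : Fin n) :
    ((Hᵀ * H) a b).natAbs ≤ n * (M * M) := by
  rw [Matrix.mul_apply]
  refine (Int.natAbs_sum_le _ _).trans ?_
  calc ∑ k, (Hᵀ a k * H k b).natAbs ≤ ∑ _k : Fin n, M * M := Finset.sum_le_sum fun k _ => by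
        rw [Int.natAbs_mul, transpose_apply]; exact Nat.mul_le_mul (hH k a) (hH k b)
    _ = n * (M * M) := by simp

/-- `size m ≤ e + 1` when `m ≤ 2^e`. [folklore] -/
theorem size_le_succ_of_le_two_pow {m e : ℕ} (h : m ≤ 2 ^ e) : m.size ≤ e + 1 :=
  Nat.size_le.2 (lt_of_le_of_lt h (Nat.pow_lt_pow_right (by norm_num) (Nat.lt_succ_self e)))

/-- **Exact Gram certificates of polynomial size** (the named fact `psd_cert_exists` of
`GapCVPCoNPComplete.lean` in the form with a MARGIN, which is what the coNP verifier needs):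
a symmetric integer `n × n` matrix `Q` with `uᵀQu ≥ 2^{-K}‖u‖²` for all real `u` and entries at
most `2^S` in absolute value admits `R ∈ ℤ^{m×n}`, `m ≤ 5(n+1)²`, and `σ ≥ 1` with `σ² Q = RᵀR`, all
of bit size `≤ 9(n + K + S) + 20`. Construction: a real Gram factor `G` of `Q − 2^{-K-1}I` (spectral
theorem, via Mathlib's `CStarAlgebra.nonneg_iff_eq_star_mul_self` for matrices), rounded at scale
`2^T` to an integer `H`; the remainder `2^{K+1+2T}Q − 2^{K+1}HᵀH` is diagonally dominant, hence twice
it is an explicit sum of `|F_{ij}|(eᵢ ± eⱼ)(eᵢ ± eⱼ)ᵀ` and `rᵢ eᵢeᵢᵀ` with nonnegative integer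
coefficients, each written with Lagrange's four squares. (Schrijver 1986, §3.3 proves polynomial
size for exact Gaussian elimination, which would give the margin-free statement; not used.)
[folklore] -/
theorem exists_gram_cert_of_margin (n K S : ℕ) (Q : Matrix (Fin n) (Fin n) ℤ) (hQ : Qᵀ = Q)
    (hmargin : ∀ u : Fin n → ℝ, u ⬝ᵥ u ≤ 2 ^ K * (u ⬝ᵥ (Q.map (Int.cast : ℤ → ℝ) *ᵥ u)))
    (hS : ∀ i k, (Q i k).natAbs ≤ 2 ^ S) :
    ∃ (m : ℕ) (R : Matrix (Fin m) (Fin n) ℤ) (σ : ℕ), σ ≠ 0 ∧ ((σ : ℤ) ^ 2) • Q = Rᵀ * R ∧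
      m ≤ 5 * (n + 1) ^ 2 ∧ σ.size ≤ 9 * (n + K + S) + 20 ∧
      ∀ i k, (R i k).natAbs.size ≤ 9 * (n + K + S) + 20 := by
  obtain ⟨H, hH, hslack⟩ := exists_rounded_factor n K S Q hQ hmargin hS
  set T : ℕ := K + S + 2 * n + 3 with hT
  set σ₀ : ℤ := (2 : ℤ) ^ (K + 1 + 2 * T) with hσ₀
  set ν : ℤ := (2 : ℤ) ^ (K + 1) with hν
  set F : Matrix (Fin n) (Fin n) ℤ := σ₀ • Q - ν • (Hᵀ * H) with hF
  have hσ₀pos : 0 < σ₀ := by rw [hσ₀]; positivity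
  have hFt : Fᵀ = F := by
    rw [hF, transpose_sub, transpose_smul, transpose_smul, transpose_mul, transpose_transpose, hQ]
  -- four squares
  have hcp : ∀ p : Fin n × Fin n, ∃ x : Fin 4 → ℤ, ∑ l, x l * x l = 2 * σ₀ * ddCoeff F p.1 p.2 := by
    intro p
    have h0 : 0 ≤ 2 * σ₀ * ddCoeff F p.1 p.2 := mul_nonneg (by positivity) (ddCoeff_nonneg F _ _)
    obtain ⟨x, hx⟩ := exists_sum_fin_four_sq (2 * σ₀ * ddCoeff F p.1 p.2).toNat
    exact ⟨x, by rw [hx, Int.toNat_of_nonneg h0]⟩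
  have hri : ∀ i : Fin n, ∃ y : Fin 4 → ℤ, ∑ l, y l * y l = 4 * σ₀ * ddSlack F i := by
    intro i
    have h0 : 0 ≤ 4 * σ₀ * ddSlack F i := mul_nonneg (by positivity) (hslack i)
    obtain ⟨y, hy⟩ := exists_sum_fin_four_sq (4 * σ₀ * ddSlack F i).toNat
    exact ⟨y, by rw [hy, Int.toNat_of_nonneg h0]⟩
  choose x hx using hcp
  choose y hy using hri
  set lam : ℤ := (2 : ℤ) ^ (K + 2 + T) with hlam
  have hlam2 : lam * lam = 4 * σ₀ * ν := by
    rw [hlam, hσ₀, hν, ← pow_add, show (4 : ℤ) = 2 ^ 2 by norm_num, ← pow_add, ← pow_add]; congr 1; ring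
  have hgram := certMatrix_gram hF hFt hlam2 hx hy
  -- reindex the rows
  set e := Fintype.equivFin (CertRows n)
  refine ⟨Fintype.card (CertRows n), Matrix.of fun r a => certMatrix lam H F x y (e.symm r) a,
    2 ^ (K + 2 + 2 * T), by positivity, ?_, ?_, ?_, ?_⟩
  · -- the identity
    rw [transpose_mul_self_reindex e, hgram, hσ₀]
    congr 1
    push_cast
    ring
  · -- `m ≤ 5 (n+1)²`
    simp only [CertRows, Fintype.card_sum, Fintype.card_prod, Fintype.card_fin]
    nlinarith
  · -- size of `σ`
    rw [Nat.size_pow, hT]; omega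
  · -- sizes of the entries
    intro r a
    simp only [Matrix.of_apply]
    -- bounds
    set Hm : ℕ := 2 ^ T * 2 ^ S + 1 with hHm
    have hHm2 : Hm ≤ 2 ^ (T + S + 1) := by
      have h1 : 1 ≤ 2 ^ T * 2 ^ S := Nat.one_le_two_pow.trans (Nat.le_mul_of_pos_right _ Nat.one_le_two_pow)
      have h2 : 2 ^ (T + S + 1) = 2 ^ T * 2 ^ S + 2 ^ T * 2 ^ S := by ring
      rw [h2, hHm]; omega
    have hHH : ∀ a b, ((Hᵀ * H) a b).natAbs ≤ n * (Hm * Hm) := natAbs_transpose_mul_self_le hH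
    have hσ₀n : σ₀.natAbs = 2 ^ (K + 1 + 2 * T) := by rw [hσ₀, Int.natAbs_pow]; rfl
    have hνn : ν.natAbs = 2 ^ (K + 1) := by rw [hν, Int.natAbs_pow]; rfl
    have hlamn : lam.natAbs = 2 ^ (K + 2 + T) := by rw [hlam, Int.natAbs_pow]; rfl
    have hFb : ∀ a b, (F a b).natAbs ≤ 2 ^ (K + 1 + 2 * T) * 2 ^ S + 2 ^ (K + 1) * (n * (Hm * Hm)) := by
      intro a b
      have e1 : F a b = σ₀ * Q a b - ν * (Hᵀ * H) a b := by
        rw [hF, Matrix.sub_apply, Matrix.smul_apply, Matrix.smul_apply, smul_eq_mul, smul_eq_mul]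
      rw [e1]
      refine (Int.natAbs_sub_le _ _).trans ?_
      rw [Int.natAbs_mul, Int.natAbs_mul, hσ₀n, hνn]
      exact Nat.add_le_add (Nat.mul_le_mul_left _ (hS a b)) (Nat.mul_le_mul_left _ (hHH a b))
    -- a single exponent dominating everything
    have hn2 : n ≤ 2 ^ n := Nat.lt_two_pow_self.le
    have hFm : 2 ^ (K + 1 + 2 * T) * 2 ^ S + 2 ^ (K + 1) * (n * (Hm * Hm)) ≤ 2 ^ (K + n + 2 * T + 2 * S + 4) := by
      have a1 : 2 ^ (K + 1 + 2 * T) * 2 ^ S ≤ 2 ^ (K + n + 2 * T + 2 * S + 3) := by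
        rw [← pow_add]; exact Nat.pow_le_pow_right (by norm_num) (by omega)
      have a2 : 2 ^ (K + 1) * (n * (Hm * Hm)) ≤ 2 ^ (K + n + 2 * T + 2 * S + 3) := by
        calc 2 ^ (K + 1) * (n * (Hm * Hm)) ≤ 2 ^ (K + 1) * (2 ^ n * (2 ^ (T + S + 1) * 2 ^ (T + S + 1))) :=
              Nat.mul_le_mul_left _ (Nat.mul_le_mul hn2 (Nat.mul_le_mul hHm2 hHm2))
          _ = 2 ^ (K + n + 2 * T + 2 * S + 3) := by rw [← pow_add, ← pow_add, ← pow_add]; congr 1; ring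
      calc _ ≤ 2 ^ (K + n + 2 * T + 2 * S + 3) + 2 ^ (K + n + 2 * T + 2 * S + 3) := Nat.add_le_add a1 a2
        _ = 2 ^ (K + n + 2 * T + 2 * S + 4) := by rw [← two_mul, ← pow_succ']
    have hFb' : ∀ a b, (F a b).natAbs ≤ 2 ^ (K + n + 2 * T + 2 * S + 4) := fun a b => (hFb a b).trans hFm
    have hbig : 4 * 2 ^ (K + 1 + 2 * T) * 2 ^ (K + n + 2 * T + 2 * S + 4) ≤ 2 ^ (9 * (n + K + S) + 19) := by
      rw [show (4 : ℕ) = 2 ^ 2 by norm_num, ← pow_add, ← pow_add]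
      exact Nat.pow_le_pow_right (by norm_num) (by rw [hT]; omega)
    refine size_le_succ_of_le_two_pow (le_trans ?_ hbig)
    rcases e.symm r with k | ⟨p, l⟩ | ⟨i, l⟩
    · -- factor rows
      simp only [certMatrix, Matrix.of_apply]
      rw [Int.natAbs_mul, hlamn]
      calc 2 ^ (K + 2 + T) * (H k a).natAbs ≤ 2 ^ (K + 2 + T) * 2 ^ (T + S + 1) := Nat.mul_le_mul_left _ ((hH k a).trans hHm2)
        _ = 2 ^ (K + 2 + T + (T + S + 1)) := by rw [← pow_add]
        _ ≤ 4 * 2 ^ (K + 1 + 2 * T) * 2 ^ (K + n + 2 * T + 2 * S + 4) := by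
            rw [show (4 : ℕ) = 2 ^ 2 by norm_num, ← pow_add, ← pow_add]
            exact Nat.pow_le_pow_right (by norm_num) (by omega)
    · -- pair rows
      simp only [certMatrix, Matrix.of_apply]
      rw [Int.natAbs_mul]
      have hxb : (x p l).natAbs ≤ 2 * 2 ^ (K + 1 + 2 * T) * 2 ^ (K + n + 2 * T + 2 * S + 4) := by
        have h1 := natAbs_le_of_sum_sq_eq (hx p) l
        have h2 : 2 * σ₀ * ddCoeff F p.1 p.2 ≤ 2 * σ₀ * (F p.1 p.2).natAbs := by
          refine mul_le_mul_of_nonneg_left ?_ (by positivity)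
          calc ddCoeff F p.1 p.2 ≤ ((ddCoeff F p.1 p.2).natAbs : ℤ) := Int.le_natAbs
            _ ≤ (F p.1 p.2).natAbs := by exact_mod_cast natAbs_ddCoeff_le F _ _
        have h3 : ((x p l).natAbs : ℤ) ≤ ((2 * 2 ^ (K + 1 + 2 * T) * (F p.1 p.2).natAbs : ℕ) : ℤ) := by
          refine (h1.trans h2).trans (le_of_eq ?_); rw [hσ₀]; push_cast; ring
        have h4 : (x p l).natAbs ≤ 2 * 2 ^ (K + 1 + 2 * T) * (F p.1 p.2).natAbs := by exact_mod_cast h3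
        exact h4.trans (Nat.mul_le_mul_left _ (hFb' _ _))
      calc (x p l).natAbs * (ddVec F p.1 p.2 a).natAbs ≤ (2 * 2 ^ (K + 1 + 2 * T) * 2 ^ (K + n + 2 * T + 2 * S + 4)) * 2 :=
            Nat.mul_le_mul hxb (natAbs_ddVec_le F _ _ _)
        _ = 4 * 2 ^ (K + 1 + 2 * T) * 2 ^ (K + n + 2 * T + 2 * S + 4) := by ring
    · -- slack rows
      simp only [certMatrix, Matrix.of_apply]
      rw [Int.natAbs_mul]
      have hyb : (y i l).natAbs ≤ 4 * 2 ^ (K + 1 + 2 * T) * 2 ^ (K + n + 2 * T + 2 * S + 4) := by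
        have h1 := natAbs_le_of_sum_sq_eq (hy i) l
        have h2 : 4 * σ₀ * ddSlack F i ≤ 4 * σ₀ * (F i i).natAbs := by
          refine mul_le_mul_of_nonneg_left ?_ (by positivity)
          calc ddSlack F i ≤ ((ddSlack F i).natAbs : ℤ) := Int.le_natAbs
            _ ≤ (F i i).natAbs := by exact_mod_cast natAbs_ddSlack_le (hslack i)
        have h3 : ((y i l).natAbs : ℤ) ≤ ((4 * 2 ^ (K + 1 + 2 * T) * (F i i).natAbs : ℕ) : ℤ) := by
          refine (h1.trans h2).trans (le_of_eq ?_); rw [hσ₀]; push_cast; ring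
        have h4 : (y i l).natAbs ≤ 4 * 2 ^ (K + 1 + 2 * T) * (F i i).natAbs := by exact_mod_cast h3
        exact h4.trans (Nat.mul_le_mul_left _ (hFb' _ _))
      calc (y i l).natAbs * (kron i a).natAbs ≤ (4 * 2 ^ (K + 1 + 2 * T) * 2 ^ (K + n + 2 * T + 2 * S + 4)) * 1 :=
            Nat.mul_le_mul hyb (natAbs_kron_le _ _)
        _ = 4 * 2 ^ (K + 1 + 2 * T) * 2 ^ (K + n + 2 * T + 2 * S + 4) := by ring

end Literature.LinearAlgebra.Matrix

end
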